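import Mathlib
import HarnessLib
import HarnessLib.Audit
import Summits.CriticalPhenomena.Statement
import Summits.CriticalPhenomena.Ising3DConformalLimit.Theorems.HyperoctahedralRPExistsScaleCovariantLimitSplitGlue
import HarnessLib.Audit.Status.Attr

/-!
Route: ModularQuarterTurn

# Route ModularQuarterTurn — Quarter turns have positive roots — lattice modular flows of the
half-plane (rotations) and of the disc (Möbius) are geometric

It suffices to show X = (E₀) ∧ (LBW) ∧ (LCHM) ∧ (NG), realising card
quarter-turns-have-positive-roots with ONE mechanism used twice:
fractional powers of an explicit positive lattice operator — the reduced density ("full turn")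
kernel of a planar region C of the critical
box Gibbs state, B_C(σ',σ) = Σ_η √(P(σ',η)·P(σ,η)) (P = probability of the whole slice-plane
configuration, η the configuration off C;
a Gram matrix, hence PSD with trace 1) — act in the scaling limit as the one-parameter group of
Möbius maps fixing ∂C pointwise.
(E₀) ExistsScaleCovariantLimit: a normalised, non-degenerate, translation-invariant, scale-covariant
pointwise scaling limit S of the critical
correlators on ℤ³ exists (shared with route HyperoctahedralRP). (LBW) WedgeModularRotation: for C =
the half-plane {x₁=0, x₀≥0} with the hinge
column pinned (then B^{1/4} is EXACTLY Baxter's quarter-turn corner transfer operator, support item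
QuarterTurnAnchors), the angle-interpolated
correlators Tr(∏ σ_i B^{φ_i/2π}) converge, after the same renormalisation ρ(δ)^n, to S at the points
rotated about the hinge axis — so S is
O(2)- and then O(3)-invariant. (LCHM) BallModularMoebius: for C = the disc {x₂=0, x₀²+x₁²<r²} the
ψ-interpolated correlators converge to
∏J_i^Δ · S at the images under the elliptic Möbius rotations M_ψ about the rim circle (Euclidean
Hislop–Longo/CHM; M_π = sphere inversion ∘
reflection) — so S is inversion covariant. (NG) IsingEuclidUpgradeR4NonGaussian (shared item
stmt-CriticalPhenomena-0636).
Lean: `ExistsScaleCovariantLimit ∧ WedgeModularRotation ∧ BallModularMoebius ∧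
IsingEuclidUpgradeR4NonGaussian` (the four decls below, each a one-line Prop over
Literature.Probability.LatticeModels.{CorrFamily, HasPointwiseScalingLimit, criticalCorr,
NonCoincident, IsNondegenerateTwoPoint, IsTranslationInvariant, IsEuclideanInvariant,
IsScaleCovariant, IsRotationInvariant, IsInversionCovariant, HasNontrivialU4, isingExpect, zdGraph,
box, criticalBeta, BoundaryCondition.plus, Site, spinMonomial, latticeApprox}, Mathlib `cfc`,
`Matrix.trace`, `Matrix.diagonal`, `Matrix.of`, `Real.sqrt`, `TendstoLocallyUniformlyOn`,
`nhdsWithin`, `EuclideanSpace`; all nine decls + Assembly elaborate together in the planner's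
Sketch.lean, lean check rc 0)

## Assembly
Pure logic plus uniqueness of limits. Take (ρ, Δ, S) from ExistsScaleCovariantLimit.
WedgeModularRotation gives L and, for each n, locally
uniform convergence of the interpolated words to S∘cyl on the wedge domain; the word is
syntactically independent of the offset c, so by
TendstoLocallyUniformlyOn.tendsto_at and tendsto_nhds_unique (𝓝[>]0 is NeBot) S n (cyl(c,p)) = S n
(cyl(c',p)); AxialRotationUpgrade turns
this into IsRotationInvariant S, hence IsEuclideanInvariant S. BallModularMoebius now applies (its
extra hypothesis is Euclidean invariance);
the same uniqueness argument gives c-independence of (∏J)^Δ·S∘M, and ToroidalInversionUpgrade yields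
IsInversionCovariant Δ S. So
IsMoebiusCovariant Δ S := ⟨⟨translation, rotation⟩, scale, inversion⟩;
IsingEuclidUpgradeR4NonGaussian gives HasNontrivialU4 S; with ρ>0,
Δ>0, the limit and non-degeneracy this is
Literature.Probability.LatticeModels.CritIsing3DConformalLimit = Ising3DConformalLimit.
QuarterTurnAnchors and FiniteVolumeScalingLimit are not in the implication chain: they are the
provable-now facts the crux provers start from.

Rationale: WHY THIS LINE. Clause (ii) of the conjunct needs O(3) and the unit inversion, and on ℤ³ neither has
a lattice handle: rotation invariance is only postulated
(DuminilCopinICM2022 §8.1) and "scale ⇒ conformal" is Polyakov's prediction, false for general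
Euclidean+scale data (barrier
ScaleCovarianceNotMoebius). In algebraic QFT both symmetries ARE modular flows — Bisognano–Wichmann
for wedges (BisognanoWichmann1976; converse
direction: geometric modular action ⇒ spacetime symmetry, BuchholzEtAl2000) and Hislop–Longo /
Casini–Huerta–Myers for double cones = balls
(HislopLongo1982, BrunettiGuidoLongo1993, CasiniHuertaMyers2011) — and on the lattice the
corresponding density operators are explicit and
POSITIVE: Baxter's corner transfer matrices multiply to the half-space density matrix (Baxter1976,
Thacker1986 "CTM = lattice boost",
PeschelKaulkeLegeza1999), and lattice entanglement Hamiltonians are numerically of BW/CHM form even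
for the 2D transverse-field Ising class
(GiudiciEtAl2018, DalmonteVermerschZoller2018, ZhangEtAl2020; limits: YangDingYan2026). What is
imported: Tomita–Takesaki/BW modular theory
(as the predicted FORM of log B), CTM technology from 2D integrable models, and the Rokhsar–Kivelson
observation that a reflection-positive
classical model's transfer-matrix vacuum is √P so that reduced density matrices are Gram kernels Σ_η
√(PP') (FradkinMoore2006) — this makes
every object a finite explicit matrix over existing Lean declarations, PSD for free, with diagonal
reflection positivity (FILS1978; in tree
isingMeasure_univ_free_reflectionPositive) entering exactly once: to identify B^{1/4} with the
quarter-turn CTM (exact anchors at all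
multiples of π/2). New vs prior routes: HyperoctahedralRP uses the same nine mirrors analytically on
the TWO-point kernel (HRP2Rigidity) and
imports inversion as the unexplained upgrade InversionUpgradeNormalised;
IsingEuclidUpgrade/IsingCFTData postulate the upgrade or the CFT
axioms; here both rotations and inversion are statements about fractional powers of two explicit
positive matrices, n-point from the start,
and modular-angle positivity (Tr(X B^s Xᵀ B^{1-s}) ≥ 0, an exact lattice KMS positivity) is a handle
bare correlators do not have. The
negatives index (one refuted SAW statement) is not touched.

RANKED CRUXES. #2 WedgeModularRotation (crux) — (LBW, card item A1, spine.) For every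
renormalisation ρ>0 on (0,1], Δ>0 and family S such that ρ(δ)^n⟨∏σ_{[x_i/δ]}⟩⁺_{β_c} → S locally
uniformly off diagonals, S normalised, non-degenerate, translation invariant and scale covariant,
there is a box growth L : ℝ → ℕ such that for every n the angle-interpolated correlators of the box
Λ = {−L(δ),…,L(δ)}³ (+ boundary condition, β = β_c(3), h = 0) converge: with P = half-plane {x₁=0,
x₀≥0} ∩ Λ, E = {x₁=0, x₀<0} ∩ Λ, Pr(σ,η) = Gibbs probability that the plane configuration is (σ on
P, η on E), B(σ',σ) = [σ' = σ on the hinge x₀=0]·Σ_η √(Pr(σ',η)Pr(σ,η)) (PSD, trace 1), insertions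
G_i = diagonal spin at the P-site (⌊r_i/δ⌋, 0, ⌊z_i/δ⌋) and gap angles φ_i ≥ 0 with Σφ_i = 2π,
ρ(δ)^n · Tr(∏_i G_i · B^{φ_i/2π}) → S n ((r_i cos θ_i, r_i sin θ_i, z_i))_i with θ_i = c + Σ_{j<i}
φ_j, locally uniformly in (c, (φ_i, r_i, z_i)_i) on {r_i > 0, φ_i ≥ 0, Σφ = 2π, image
non-coincident} (B^s := cfc (x ↦ x^s) B, the PSD functional calculus). The word does not contain c,
so the limit is invariant under all rotations about the hinge axis; at φ_i ∈ (π/2)ℕ the word equals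
the true box correlator exactly (QuarterTurnAnchors). [difficulty: open-problem] (why it might fail:
As strong as rotation invariance plus convergence of lattice entanglement spectra near the hinge;
lattice BW is only approximate off integrability (YangDingYan2026) and log B need not be local far
from the hinge in a + box, so non-geometric corrections might not vanish as δ→0.) [Baxter1976,
Thacker1986, PeschelKaulkeLegeza1999, BisognanoWichmann1976, BuchholzEtAl2000, GiudiciEtAl2018,
YangDingYan2026, DuminilCopinICM2022]
#3 BallModularMoebius (crux) — (LCHM, card item A2, Euclidean form.) For every ρ>0, Δ>0, S with the
pointwise scaling limit as above, S normalised, non-degenerate, EUCLIDEAN invariant and scale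
covariant with dimension Δ, and every radius r>0, there is a box growth L such that for every n:
with D = disc {x₂=0, x₀²+x₁² < (r/δ)²} ∩ Λ, E = rest of the plane {x₂=0} ∩ Λ, K(τ',τ) = Σ_η
√(Pr(τ',η)Pr(τ,η)) (the reduced density matrix of the disc in the transfer-matrix vacuum √Pr; PSD,
trace 1), insertions G_i = spin at (⌊a_i/δ⌋, ⌊b_i/δ⌋, 0) ∈ D and gaps φ_i ≥ 0, Σφ_i = 2π, ρ(δ)^n ·
Tr(∏_i G_i · K^{φ_i/2π}) → (∏_i J_i)^Δ · S n (M_{ψ_i}(a_i,b_i,0))_i locally uniformly on {0 <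
a_i²+b_i² < r², φ_i ≥ 0, Σφ = 2π, image non-coincident}, where ψ_i = c + Σ_{j<i}φ_j, t_i² =
(a_i²+b_i²)/r², J_i = 2/((1+t_i²) + (1−t_i²)cos ψ_i) is the conformal factor and M_ψ(a,b,0) = (J a,
J b, −(r/2)(1−t²) sin ψ · J) is the elliptic Möbius rotation by ψ about the rim circle {x₂=0, |x|=r}
(toroidal angle shift; M_π = inversion in the sphere of radius r composed with x₂ ↦ −x₂, M_{π/2}
lands on that sphere). Again the word does not contain c, so (∏J)^Δ·S∘M is c-invariant: covariance
under the elliptic one-parameter group, hence (with Euclidean + scale) under the whole Möbius group.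
[deps: WedgeModularRotation] [difficulty: open-problem] (why it might fail: No exact anchors except
ψ ∈ 2πℤ; in a scale- but not Möbius-covariant limit log K is not the CHM generator (a virial current
spoils it), so this is precisely where ScaleCovarianceNotMoebius bites; rim (edge-mode) lattice
effects in the entanglement spectrum might persist as δ→0.) [HislopLongo1982,
BrunettiGuidoLongo1993, CasiniHuertaMyers2011, DalmonteVermerschZoller2018, ZhangEtAl2020,
FradkinMoore2006, PolandRychkovVichi2019]
#4 ExistsScaleCovariantLimit (crux) — (E₀, shared verbatim with route HyperoctahedralRP.) There
exist ρ>0 on (0,1], Δ>0 and S with HasPointwiseScalingLimit (criticalCorr 3) ρ S, S = 0 off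
NonCoincident (normalisation), IsNondegenerateTwoPoint S, IsTranslationInvariant S, IsScaleCovariant
Δ S — existence of the limit with NO rotation or inversion clause (isotropy and inversion are
outputs of this route). [difficulty: open-problem] (why it might fail: Existence of the δ→0 limit
along the full family (not subsequences), translation invariance of S and pure-power scale
covariance with one Δ are each open on ℤ³ (DuminilCopinICM2022 §8.4); ρ might need non-power
corrections.) [DuminilCopinICM2022, AizenmanDuminilCopinSidoravicius2015, PolandRychkovVichi2019]
#5 IsingEuclidUpgradeR4NonGaussian (crux) — (NG, shared item stmt-CriticalPhenomena-0636, verbatim.)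
Every non-degenerate pointwise scaling limit S of the renormalised critical correlators on ℤ³ has
connected four-point function U₄ ≢ 0 on non-coincident configurations. [difficulty: open-problem]
(why it might fail: Non-triviality in d = 3 is open; the only rigorous tool, the random-current
intersection identity, needs a LOWER bound on macroscopic intersections of two critical
double-current clusters (d ≥ 4 gives the opposite, triviality).) [Aizenman1982,
AizenmanDuminilCopinAnnals2021, DuminilCopinICM2022]
#9 QuarterTurnAnchors (support) — (Card item A0 in exact form; provable now.) For every box size L:
with P, E, Pr, B as in WedgeModularRotation (mesh irrelevant) and A := cfc (x ↦ x^{1/4}) B the PSD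
fourth root, for all four observables g₀,…,g₃ of the half-plane configuration, Tr(A·diag g₃·A·diag
g₂·A·diag g₁·A·diag g₀) = ⟨∏_k g_k(ω∘R^k|_P)⟩_{Λ,β_c,+} where R(y) = (−y₁, y₀, y₂) is the lattice
quarter turn about the hinge axis. Content: Z·√(Pr Pr') is the cut partition function (all in-plane
bond conventions cancel), so B = ⊕_h Ã_h⁴/Z blockwise in the hinge configuration h, where Ã_h is
Baxter's corner transfer operator of the quadrant {x₀,x₁ ≥ 0} (walls weighted ½, hinge line ¼); Ã_h
is symmetric and PSD by reflection positivity in the diagonal site-plane x₀ = x₁, which no n.n. bond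
crosses (pattern of the proved isingMeasure_univ_free_reflectionPositive); uniqueness of PSD fourth
roots gives A = ⊕_h Ã_h / Z^{1/4}, and the CTM trace formula gives the identity. This is "quarter
turns have positive roots" made exact and anchors WedgeModularRotation at all multiples of π/2.
[difficulty: L] [Baxter1976, PeschelKaulkeLegeza1999, FILS1978, FriedliVelenik2017]
#9 AxialRotationUpgrade (support) — (Card item A3, group bookkeeping for rotations; provable now.)
If S is a normalised, translation-invariant pointwise scaling limit of criticalCorr 3 (hypotheses as
in WedgeModularRotation) and S n (cyl(c,p)) = S n (cyl(c',p)) for all offsets c, c' whenever (c,p)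
lies in the wedge domain (whose conditions do not involve the offset; this is the exact shape of the
conclusion of WedgeModularRotation: invariance under rotations about the x₂-axis for angle-sorted
configurations off the axis), then IsRotationInvariant S (all of O(3), all configurations). Proof
sketch: permutation symmetry of S from the lattice; configurations meeting the axis via a parallel
axis and translation invariance; the other coordinate axes by the exact coordinate-permutation
symmetry of criticalCorr and ⌊·⌋; reflections x ↦ −x via ⌊−t⌋ = −⌊t⌋−1 = a common lattice
translation plus translation invariance of S; two axial SO(2)'s generate SO(3). [difficulty: M]
[DuminilCopinICM2022, FriedliVelenik2017]
#9 ToroidalInversionUpgrade (support) — (Card item A3, group bookkeeping for inversion; provable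
now, pure Möbius geometry.) If S is normalised, Euclidean invariant and scale covariant with Δ > 0
(plus the scaling-limit hypotheses, used only for permutation symmetry) and, for every r > 0, (∏J)^Δ
· S n (M_ψ-images) is independent of the common toroidal offset c on the disc domain (offset-free
membership conditions; the exact shape of the conclusion of BallModularMoebius), then
IsInversionCovariant Δ S. Proof sketch: every configuration avoiding the rim circle is an M-image of
disc points (toroidal coordinates cover ℝ³ minus the circle; choose the plane generically); offset c
↦ c+π realises M_π = (inversion in the sphere of radius r) ∘ (x₂ ↦ −x₂) with J(ψ+π)/J(ψ) = |M_π'| =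
r²/|x|²; remove the reflection by Euclidean invariance and the radius by scale covariance.
[difficulty: M] [HislopLongo1982, BrunettiGuidoLongo1993]
#9 FiniteVolumeScalingLimit (support) — (Card item A4, limit interchange; provable now from GKS.) If
ρ(δ)^n⟨∏σ_{[x_i/δ]}⟩⁺_{β_c} → S n locally uniformly on NonCoincident, then there is L₀ : ℝ → ℕ such
that for every box growth L ≥ L₀ the + boundary box correlators
ρ(δ)^n⟨∏σ_{[x_i/δ]}⟩_{Λ_{L(δ)},β_c,+} have the same locally uniform limit S n. (At each fixed δ only
finitely many lattice configurations matter on a compact exhaustion, and ⟨σ_A⟩⁺_Λ ↓ ⟨σ_A⟩⁺ by GKS —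
hasBoxLimit_isingCorr_plus_holds — so L₀(δ) can be chosen with error ≤ δ·ρ(δ)^{-n} for all n ≤ 1/δ.)
Used by the provers of both modular cruxes to identify the anchored values with S. [difficulty: M]
[FriedliVelenik2017, AizenmanDuminilCopinSidoravicius2015]

TWO-LAYER PLAN. Foreseen glued splits, none filed now. WedgeModularRotation ⇐ (W1) thermodynamic
limit of the interpolated words at fixed mesh (existence of
lim_{L→∞} Tr(∏G_i B_L^{φ_i/2π}), a monotonicity-free statement about entanglement spectra) → (W2)
two-point geometric interpolation (n = 2,
equal (r,z): there the word is EXACTLY exponentially convex in the angle, Σ_{jk}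
λ_j^{1-u}λ_k^u|G_jk|², and the conformal prediction
(2r sin(θ/2))^{-2Δ} is exponentially convex as well — checked: (cos x)^{-2Δ} = ∫cosh(xt)w(t)dt with
w ∝ |Γ(Δ+it/2)|² > 0) → (W3) n-point from
2-point words by the lattice KMS/Araki multiple-angle analyticity → WedgeModularRotation.
BallModularMoebius ⇐ (B1) the half turn only
(φ = (π, π): K^{1/2}, "the full turn about a circle has a positive square root = sphere inversion ∘
reflection"; gives inversion covariance for
n ≤ 3 and coplanar configurations) → (B2) general ψ → BallModularMoebius. A purely operator-level
child "‖log B + 2π·K_BW‖ small on the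
low-lying entanglement spectrum" is deliberately NOT foreseen as an item (wrong topology;
correlator-level statements are what assemble).

KILL CRITERIA. Refutation of WedgeModularRotation (e.g. a proof that for the critical n.n. model the
eighth-turn word Tr(G B^{1/8} G' B^{7/8}) stays
boundedly away, after renormalisation, from the diagonal-pair correlator, or certified 3D
corner-tensor numerics showing a stable O(1)
discrepancy at θ = π/4 in the scaling regime) closes the route outright: `close --reason
refuted:WedgeModularRotation` — the disc version
cannot survive if the anchored wedge version fails. Refutation of BallModularMoebius alone forces a
pivot to "rotations from modular flow,
inversion imported" (re-rank: keep LBW, replace LCHM by the shared InversionUpgradeNormalised of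
HyperoctahedralRP). Refutation of
ExistsScaleCovariantLimit in the form "two subsequential limits with different Δ" kills every route
to the conjunct as typed; refutation
of IsingEuclidUpgradeR4NonGaussian ("some non-degenerate limit is Gaussian") refutes the conjunct
itself. If HyperoctahedralRP proves
LimitRotationInvariant first, LBW becomes a corollary-flavoured statement and staffing should move
to BallModularMoebius.

NOT DECOMPOSED YET. Deliberately not decomposed at open: the thermodynamic limit of fractional-power
words (W1); the identification of −(1/2π)log B with a
lattice BW Hamiltonian Σ x₀ h_x (an operator statement we do not need); Hölder/Araki bounds |Tr(∏G_i
B^{a_i})| ≤ 1; the n.n. transfer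
matrix T and H = −log T (the card's Lorentzian K⁰ = R²H + (R/π)log ρ_B is replaced by the Euclidean
toroidal flow of log K alone, so T
never appears); tightness/regularity of S (continuity is never used: reflections are handled by
lattice translations); constants in the
finite-volume error (FiniteVolumeScalingLimit chooses L₀ qualitatively). These are layer-2 children
once a crux closes.

CHEAPEST FALSIFIER. (1) Analytic, run by the planner: for two identical insertions the interpolated
word is exactly exponentially convex in the angle (PSD B),
so the conformal prediction on a circle about the hinge, θ ↦ (2r sin(θ/2))^{-2Δ}, must be
exponentially convex on (0,2π) — it is for every
Δ > 0 ((cos x)^{-2Δ} is a positive cosh-mixture, weight ∝ |Γ(Δ+it/2)|²); the disc case reduces to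
the wedge by the Möbius map straightening
the rim, and the check fixes the exponent +Δ of the conformal factor in BallModularMoebius. Passed;
the toroidal formulas (M_π = sphere
inversion ∘ reflection, |M_ψ'| = J) were verified numerically to 1e-10. (2) Cheapest numerical kill
(kit; not run this session): 2D sanity —
critical square-lattice Ising CTMRG, compare the eighth-turn word Tr(G A^{1/2} G A^{7/2}) with the
exactly known diagonal correlator
⟨σ_{0,0}σ_{t,t}⟩ (agreement is forced there); then the 3D model with Nishino–Okunishi corner tensors
(OkunishiNishino2000) at
β_c ≈ 0.2216546: a stable O(1) relative discrepancy at θ = π/4 for r ≪ L refutes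
WedgeModularRotation. (3) Lookup kill: a proof that 2D
TFIM-class entanglement Hamiltonians deviate from BW at LEADING order (YangDingYan2026: sub-leading
only).

NUMBERS. β_c(3) ≈ 0.221654626(5) (MC, Ferrenberg–Xu–Landau 2018); Δ_σ = 0.5181489(10), so 2Δ = 1+η
with η ≈ 0.036298 (bootstrap, PolandRychkovVichi2019
Table II); rigorous window 1/2 ≤ Δ ≤ 1 from c|x|⁻² ≤ ⟨σ₀σ_x⟩_{β_c} ≤ C|x|⁻¹ (in tree:
criticalTwoPoint_bounds, scalingDimension_mem_Icc).
BW temperature 2π (K = −(1/2π) log B); CTM spectra at criticality are equally spaced with spacing ∝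
π²/log(L) in 2D (Peschel–Truong 1987,
PeschelKaulkeLegeza1999), the expected size of finite-L corrections to geometric interpolation.

DEFINITION REQUESTS. None required at open: every object (plane marginal Pr, Gram kernel B/K,
fractional powers via Mathlib `cfc`, cylindrical and toroidal
image points, conformal factor J) is inlined over existing declarations and elaborates. Desirable
later, for readability of Theorems files
(to be filed by the tenure planner if provers ask): Literature notion `planeMarginalKernel` (the
Gram kernel Σ_η √(P P') of a region of a
reflection plane, with its PSD/trace-one lemmas) under Literature/Probability/LatticeModels, and
`cornerTransferOperator` (Baxter1976) with
the factorisation lemma of QuarterTurnAnchors.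

Novelty: Searches (2026-08-15): `lit search --source crossref` "corner transfer matrix Lorentz invariance
lattice Thacker" (10 hits: Thacker1986,
Itoyama–Thacker 1987, Frahm–Thacker 1991, Orús–Vidal 2009 CTMRG…), "entanglement Hamiltonian
Bisognano Wichmann lattice models" (12: GiudiciEtAl2018,
ZhangEtAl2020, YangDingYan2026, Eisler 2025, Mund 2001, Jakóbczyk 1993 "BW duality in Euclidean
field theory"), "density matrix spectra
integrable models corner transfer matrices" (8: PeschelKaulkeLegeza1999, Davies–Peschel 1991,
Peschel–Truong 1991), "Rokhsar-Kivelson wave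
function entanglement … reduced density matrix" (8: FradkinMoore2006, Hsu–Mulligan–Fradkin–Kim 2009,
Castelnovo et al. 2005), "Hislop Longo
modular structure …" (6: HislopLongo1982, BrunettiGuidoLongo1993, Fredenhagen 1985), "Geometric
modular action …" (5: BuchholzEtAl2000);
`lit galaxy search "corner transfer matrix" --star all` (30 rows: Takahashi, Tao Xiang DMRG/TN book,
Jimbo YBE volume, Sierra's entanglement
notes, CTMRG papers — none on fractional CTM powers as rotations in 3D or on modular flows as a
route to conformal covariance),
`lit galaxy search "corner transfer matrix three dimensions" --star all` (0); `lit frontier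
CriticalPhenomena --since 2020` and `lit bridges
CriticalPhenomena --cross any` (no modular/CTM entries); local searchd, OpenAlex and arXiv were
unavailable/rate-limited this session (logged);
`ledger negatives --problem CriticalPhenomena` (1 SAW statement, unrelated); the five open routes of
the su  [refs: 10.1016/0167-2789(86, doi:10.1016/0167-2789, Thacker1986, GiudiciEtAl2018, ZhangEtAl2020, YangDingYan2026, PeschelKaulkeLegeza1999, FradkinMoore2006, HislopLongo1982, BrunettiGuidoLongo1993, BuchholzEtAl2000, CasiniHuertaMyers2011, DalmonteVermerschZoller2018]

Barriers (technique_class: corner-transfer-matrix, modular-hamiltonian, RP): - technique_class: corner-transfer-matrix, modular-hamiltonian, RP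
- Literature.Barriers.CriticalPhenomena.ScaleCovarianceNotMoebius: engaged by BallModularMoebius
only and evaded in type — nothing is upgraded from abstract Euclidean+scale data; the input is
convergence of fractional powers of an explicit positive matrix of the Ising box Gibbs state (the
barrier's witness family has no lattice model, no Gram kernel and no modular-angle positivity); the
bet is stated openly in that crux's why-line.
- Literature.Barriers.CriticalPhenomena.LiouvilleRigidity: respected — only the Möbius group of
ℝ³∪{∞} is produced (rotations about lines, elliptic rotations about circles, similarities); no local
conformal maps; consistent with the 2D contrast where the same CTM construction yields a lattice
Virasoro (Itoyama–Thacker).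
- Literature.Barriers.CriticalPhenomena.BootstrapLatticeBlindness: not in class — every crux is a
statement about lattice operators of the n.n. model at β_c(3); CFT enters only as the predicted
geometric form of their logarithms, never as an axiom on S.
- Literature.Barriers.CriticalPhenomena.RigorousRGSmallParameter: not in class — no RG map, no small
parameter, no expansion; corner-tensor RG is a numerical falsifier, not an ingredient.
- Literature.Barriers.CriticalPhenomena.PositionSpaceRGNonGibbsian: not in class — no
block-spin/decimation map is iterated; the plane marginal P is used only inside finite Gram sums,
never as a renormalised Hamiltonian.
- Literature

Novelty grade: new-combination — ROUTE REVIEW + novelty (refuter, 2026-08-15). Nearest prior art (planner's documented searches; searchd was unavailable to me, rc 75 ×3, so graded on their list + domain knowledge): Thacker1986 / Itoyama–Thacker (CTM = lattice rotation/boost generator with exact angle addition, 2D Z-invariant only), (refuter refuter-rreview-route-CriticalPhenomena--9bd92947-0, 2026-08-15T13:50:17Z; prior: Thacker1986,PeschelKaulkeLegeza1999,BisognanoWichmann1976,BuchholzEtAl2000,HislopLongo1982,CasiniHuertaMyers2011,FradkinMoore2006,GiudiciEtAl2018,DalmonteVermerschZoller2018)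

History (route lifecycle, newest last):
- 2026-08-15T16:54:49Z · rev 4: restated Assembly (stmt-CriticalPhenomena-6499) — route-repair (cone): (1) reset imports — remove the spurious auto-import Literature.NumberTheory.LFunctions.ExceptionalPrimesAssembly (the resolver matched the (planner-rrepair-CriticalPhenomena-ModularQuart-693a2b9f-g2-0)
- 2026-08-17T08:41:29Z · rev 6: dropped TwoPointDoubling, ClusterSetTotallyDisconnected — strategist s1 (instance ModularQuarterTurn): clear the HALF-APPLIED split state (attempt 6 attached the two children to this route at ranks 401/402 with parent= (operator:999:609105)
- 2026-08-25T16:05:31Z · DORMANT — reconciler: no traction for 7.8 d (last activity item-evidence-added at 2026-08-17T19:18:53Z); parked, not closed — `ledger route dormant route-CriticalPhenomen (operator:999:2561065)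
- 2026-08-27T15:24:11Z · REACTIVATED — reconciler: reactivated — activity statement-checked at 2026-08-27T13:51:04Z after parking at 2026-08-25T16:05:31Z (operator:999:1485260)

sub-problem: Ising3DConformalLimit · status: open · opened planner-plancard-CriticalPhenomena-Ising3DCon-d19afdff-0 2026-08-15T11:47:41Z · rev 6 · ledger route-CriticalPhenomena-ModularQuarterTurn
GENERATED by the gate from the ledger (D-0016/17). Provers cite these decls: `theorem foo : Summit.CriticalPhenomena.Ising3DConformalLimit.Theses.ModularQuarterTurn.<Decl> := …` in Summits/CriticalPhenomena/Ising3DConformalLimit/Theorems/<Name>.lean.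
-/

namespace Summit.CriticalPhenomena.Ising3DConformalLimit.Theses.ModularQuarterTurn

open scoped BigOperators Topology Manifold Classical MeasureTheory ProbabilityTheory Matrix InnerProductSpace ComplexConjugate ContinuousMap
open Filter Set Function TopologicalSpace MeasureTheory

attribute [summit_statement] _root_.Ising3DConformalLimit

/-- item stmt-CriticalPhenomena-6493 · crux · rank 2 · open · by planner
why it might fail: As strong as rotation invariance plus convergence of lattice entanglement spectra near the hinge; lattice BW is only approximate off integrability (YangDingYan2026) and log B need not be local far from the hinge in a + box, so non-geometric corrections might not vanish as δ→0.
sources: Baxter1976, Thacker1986, PeschelKaulkeLegeza1999, BisognanoWichmann1976, BuchholzEtAl2000, GiudiciEtAl2018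
[crux] (LBW, card item A1, spine.) For every renormalisation ρ>0 on (0,1], Δ>0 and family S such
that ρ(δ)^n⟨∏σ_{[x_i/δ]}⟩⁺_{β_c} → S locally uniformly off diagonals, S normalised, non-degenerate,
translation invariant and scale covariant, there is a box growth L : ℝ → ℕ such that for every n the
angle-interpolated correlators of the box Λ = {−L(δ),…,L(δ)}³ (+ boundary condition, β = β_c(3), h =
0) converge: with P = half-plane {x₁=0, x₀≥0} ∩ Λ, E = {x₁=0, x₀<0} ∩ Λ, Pr(σ,η) = Gibbs probability
that the plane configuration is (σ on P, η on E), B(σ',σ) = [σ' = σ on the hinge x₀=0]·Σ_η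
√(Pr(σ',η)Pr(σ,η)) (PSD, trace 1), insertions G_i = diagonal spin at the P-site (⌊r_i/δ⌋, 0,
⌊z_i/δ⌋) and gap angles φ_i ≥ 0 with Σφ_i = 2π, ρ(δ)^n · Tr(∏_i G_i · B^{φ_i/2π}) → S n ((r_i cos
θ_i, r_i sin θ_i, z_i))_i with θ_i = c + Σ_{j<i} φ_j, locally uniformly in (c, (φ_i, r_i, z_i)_i) on
{r_i > 0, φ_i ≥ 0, Σφ = 2π, image non-coincident} (B^s := cfc (x ↦ x^s) B, the PSD functional
calculus). The word does not contain c, so the limit is invariant under all rotations about the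
hinge axis; at φ_i ∈ (π/2)ℕ the word equals the true box correlator exactly (QuarterTurnAnchors).
[difficulty: open-problem] -/
@[route_item "route-CriticalPhenomena-ModularQuarterTurn", crux]
def WedgeModularRotation : Prop :=
  ∀ (ρ : ℝ → ℝ) (Δ : ℝ) (S : Literature.Probability.LatticeModels.CorrFamily 3), (∀ δ ∈ Set.Ioc (0:ℝ) 1, 0 < ρ δ) → 0 < Δ → Literature.Probability.LatticeModels.HasPointwiseScalingLimit (Literature.Probability.LatticeModels.criticalCorr 3) ρ S → (∀ n z, z ∉ Literature.Probability.LatticeModels.NonCoincident 3 n → S n z = 0) → Literature.Probability.LatticeModels.IsNondegenerateTwoPoint S → Literature.Probability.LatticeModels.IsTranslationInvariant S → Literature.Probability.LatticeModels.IsScaleCovariant Δ S → ∃ L : ℝ → ℕ, ∀ n : ℕ, TendstoLocallyUniformlyOn (fun (δ : ℝ) (q : ℝ × (Fin n → ℝ × ℝ × ℝ)) => ρ δ ^ n * (let P : Finset (Literature.Probability.LatticeModels.Site 3) := (Literature.Probability.LatticeModels.box 3 (L δ)).filter (fun x => x 1 = 0 ∧ 0 ≤ x 0); let E : Finset (Literature.Probability.LatticeModels.Site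 3) := (Literature.Probability.LatticeModels.box 3 (L δ)).filter (fun x => x 1 = 0 ∧ x 0 < 0); let Pr : (↥P → ℤˣ) → (↥E → ℤˣ) → ℝ := fun σ η => Literature.Probability.LatticeModels.isingExpect (Literature.Probability.LatticeModels.zdGraph 3) (Literature.Probability.LatticeModels.box 3 (L δ)) (Literature.Probability.LatticeModels.criticalBeta 3) 0 Literature.Probability.LatticeModels.BoundaryCondition.plus (fun ω => (∏ x : ↥P, if ω x.1 = σ x then (1:ℝ) else 0) * ∏ y : ↥E, if ω y.1 = η y then (1:ℝ) else 0); let B : Matrix (↥P → ℤˣ) (↥P → ℤˣ) ℝ := Matrix.of (fun σ' σ => if (∀ x : ↥P, x.1 0 = 0 → σ' x = σ x) then ∑ η : ↥E → ℤˣ, Real.sqrt (Pr σ' η * Pr σ η) else 0); let G : Fin n → Matrix (↥P → ℤˣ) (↥P → ℤˣ) ℝ := fun i => Matrix.diagonal (fun σ => if h : (![⌊(q.2 i).2.1 / δ⌋, 0, ⌊(q.2 i).2.2 / δ⌋] : Literature.Probability.LatticeModels.Site 3) ∈ P then (((σ ⟨_, h⟩ : ℤˣ) : ℤ) : ℝ)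 else 0); Matrix.trace ((List.ofFn (fun i : Fin n => G i * cfc (fun x : ℝ => x ^ ((q.2 i).1 / (2 * Real.pi))) B)).prod))) (fun q => S n (fun i : Fin n => (!₂[(q.2 i).2.1 * Real.cos (q.1 + ∑ j : Fin n, if j < i then (q.2 j).1 else 0), (q.2 i).2.1 * Real.sin (q.1 + ∑ j : Fin n, if j < i then (q.2 j).1 else 0), (q.2 i).2.2] : EuclideanSpace ℝ (Fin 3)))) (nhdsWithin (0:ℝ) (Set.Ioi 0)) {q : ℝ × (Fin n → ℝ × ℝ × ℝ) | (∀ i, 0 ≤ (q.2 i).1 ∧ 0 < (q.2 i).2.1) ∧ ∑ i, (q.2 i).1 = 2 * Real.pi ∧ (fun i : Fin n => (!₂[(q.2 i).2.1 * Real.cos (∑ j : Fin n, if j < i then (q.2 j).1 else 0), (q.2 i).2.1 * Real.sin (∑ j : Fin n, if j < i then (q.2 j).1 else 0), (q.2 i).2.2] : EuclideanSpace ℝ (Fin 3))) ∈ Literature.Probability.LatticeModels.NonCoincident 3 n}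

/-- item stmt-CriticalPhenomena-6494 · crux · rank 3 · open · by planner
why it might fail: No exact anchors except ψ ∈ 2πℤ; in a scale- but not Möbius-covariant limit log K is not the CHM generator (a virial current spoils it), so this is precisely where ScaleCovarianceNotMoebius bites; rim (edge-mode) lattice effects in the entanglement spectrum might persist as δ→0.
sources: HislopLongo1982, BrunettiGuidoLongo1993, CasiniHuertaMyers2011, DalmonteVermerschZoller2018, ZhangEtAl2020, FradkinMoore2006
[crux] (LCHM, card item A2, Euclidean form.) For every ρ>0, Δ>0, S with the pointwise scaling limit
as above, S normalised, non-degenerate, EUCLIDEAN invariant and scale covariant with dimension Δ,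
and every radius r>0, there is a box growth L such that for every n: with D = disc {x₂=0, x₀²+x₁² <
(r/δ)²} ∩ Λ, E = rest of the plane {x₂=0} ∩ Λ, K(τ',τ) = Σ_η √(Pr(τ',η)Pr(τ,η)) (the reduced density
matrix of the disc in the transfer-matrix vacuum √Pr; PSD, trace 1), insertions G_i = spin at
(⌊a_i/δ⌋, ⌊b_i/δ⌋, 0) ∈ D and gaps φ_i ≥ 0, Σφ_i = 2π, ρ(δ)^n · Tr(∏_i G_i · K^{φ_i/2π}) → (∏_i
J_i)^Δ · S n (M_{ψ_i}(a_i,b_i,0))_i locally uniformly on {0 < a_i²+b_i² < r², φ_i ≥ 0, Σφ = 2π,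
image non-coincident}, where ψ_i = c + Σ_{j<i}φ_j, t_i² = (a_i²+b_i²)/r², J_i = 2/((1+t_i²) +
(1−t_i²)cos ψ_i) is the conformal factor and M_ψ(a,b,0) = (J a, J b, −(r/2)(1−t²) sin ψ · J) is the
elliptic Möbius rotation by ψ about the rim circle {x₂=0, |x|=r} (toroidal angle shift; M_π =
inversion in the sphere of radius r composed with x₂ ↦ −x₂, M_{π/2} lands on that sphere). Again the
word does not contain c, so (∏J)^Δ·S∘M is c-invariant: covariance under the elliptic one-parameter
group, hence (with Euclidea -/
@[route_item "route-CriticalPhenomena-ModularQuarterTurn", crux]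
def BallModularMoebius : Prop :=
  ∀ (ρ : ℝ → ℝ) (Δ : ℝ) (S : Literature.Probability.LatticeModels.CorrFamily 3), (∀ δ ∈ Set.Ioc (0:ℝ) 1, 0 < ρ δ) → 0 < Δ → Literature.Probability.LatticeModels.HasPointwiseScalingLimit (Literature.Probability.LatticeModels.criticalCorr 3) ρ S → (∀ n z, z ∉ Literature.Probability.LatticeModels.NonCoincident 3 n → S n z = 0) → Literature.Probability.LatticeModels.IsNondegenerateTwoPoint S → Literature.Probability.LatticeModels.IsEuclideanInvariant S → Literature.Probability.LatticeModels.IsScaleCovariant Δ S → ∀ r : ℝ, 0 < r → ∃ L : ℝ → ℕ, ∀ n : ℕ, TendstoLocallyUniformlyOn (fun (δ : ℝ) (q : ℝ × (Fin n → ℝ × ℝ × ℝ)) => ρ δ ^ n * (let D : Finset (Literature.Probability.LatticeModels.Site 3) := (Literature.Probability.LatticeModels.box 3 (L δ)).filter (fun x => x 2 = 0 ∧ ((x 0 : ℤ) : ℝ) ^ 2 + ((x 1 : ℤ) : ℝ) ^ 2 < (r / δ) ^ 2); let E : Finset (Literature.Probability.LatticeModels.Site 3) := (Literature.Probability.LatticeModels.box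 3 (L δ)).filter (fun x => x 2 = 0 ∧ ¬ (((x 0 : ℤ) : ℝ) ^ 2 + ((x 1 : ℤ) : ℝ) ^ 2 < (r / δ) ^ 2)); let Pr : (↥D → ℤˣ) → (↥E → ℤˣ) → ℝ := fun σ η => Literature.Probability.LatticeModels.isingExpect (Literature.Probability.LatticeModels.zdGraph 3) (Literature.Probability.LatticeModels.box 3 (L δ)) (Literature.Probability.LatticeModels.criticalBeta 3) 0 Literature.Probability.LatticeModels.BoundaryCondition.plus (fun ω => (∏ x : ↥D, if ω x.1 = σ x then (1:ℝ) else 0) * ∏ y : ↥E, if ω y.1 = η y then (1:ℝ) else 0); let K : Matrix (↥D → ℤˣ) (↥D → ℤˣ) ℝ := Matrix.of (fun τ' τ => ∑ η : ↥E → ℤˣ, Real.sqrt (Pr τ' η * Pr τ η)); let G : Fin n → Matrix (↥D → ℤˣ) (↥D → ℤˣ) ℝ := fun i => Matrix.diagonal (fun τ => if h : (![⌊(q.2 i).2.1 / δ⌋, ⌊(q.2 i).2.2 / δ⌋, 0] : Literature.Probability.LatticeModels.Site 3) ∈ D then (((τ ⟨_, h⟩ : ℤˣ) : ℤ) : ℝ)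 else 0); Matrix.trace ((List.ofFn (fun i : Fin n => G i * cfc (fun x : ℝ => x ^ ((q.2 i).1 / (2 * Real.pi))) K)).prod))) (fun q => (∏ i : Fin n, (2 / ((1 + (((q.2 i).2.1 ^ 2 + (q.2 i).2.2 ^ 2) / r ^ 2)) + (1 - (((q.2 i).2.1 ^ 2 + (q.2 i).2.2 ^ 2) / r ^ 2)) * Real.cos (q.1 + ∑ j : Fin n, if j < i then (q.2 j).1 else 0)))) ^ Δ * S n (fun i : Fin n => (!₂[(2 / ((1 + (((q.2 i).2.1 ^ 2 + (q.2 i).2.2 ^ 2) / r ^ 2)) + (1 - (((q.2 i).2.1 ^ 2 + (q.2 i).2.2 ^ 2) / r ^ 2)) * Real.cos (q.1 + ∑ j : Fin n, if j < i then (q.2 j).1 else 0))) * (q.2 i).2.1, (2 / ((1 + (((q.2 i).2.1 ^ 2 + (q.2 i).2.2 ^ 2) / r ^ 2)) + (1 - (((q.2 i).2.1 ^ 2 + (q.2 i).2.2 ^ 2) / r ^ 2)) * Real.cos (q.1 + ∑ j : Fin n, if j < i then (q.2 j).1 else 0))) * (q.2 i).2.2, -(r / 2) * (1 - (((q.2 i).2.1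 ^ 2 + (q.2 i).2.2 ^ 2) / r ^ 2)) * Real.sin (q.1 + ∑ j : Fin n, if j < i then (q.2 j).1 else 0) * (2 / ((1 + (((q.2 i).2.1 ^ 2 + (q.2 i).2.2 ^ 2) / r ^ 2)) + (1 - (((q.2 i).2.1 ^ 2 + (q.2 i).2.2 ^ 2) / r ^ 2)) * Real.cos (q.1 + ∑ j : Fin n, if j < i then (q.2 j).1 else 0)))] : EuclideanSpace ℝ (Fin 3)))) (nhdsWithin (0:ℝ) (Set.Ioi 0)) {q : ℝ × (Fin n → ℝ × ℝ × ℝ) | (∀ i, 0 ≤ (q.2 i).1 ∧ 0 < (q.2 i).2.1 ^ 2 + (q.2 i).2.2 ^ 2 ∧ (q.2 i).2.1 ^ 2 + (q.2 i).2.2 ^ 2 < r ^ 2) ∧ ∑ i, (q.2 i).1 = 2 * Real.pi ∧ (fun i : Fin n => (!₂[(2 / ((1 + (((q.2 i).2.1 ^ 2 + (q.2 i).2.2 ^ 2) / r ^ 2)) + (1 - (((q.2 i).2.1 ^ 2 + (q.2 i).2.2 ^ 2) / r ^ 2)) * Real.cos (∑ j : Fin n, if j < i then (q.2 j).1 else 0)))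 * (q.2 i).2.1, (2 / ((1 + (((q.2 i).2.1 ^ 2 + (q.2 i).2.2 ^ 2) / r ^ 2)) + (1 - (((q.2 i).2.1 ^ 2 + (q.2 i).2.2 ^ 2) / r ^ 2)) * Real.cos (∑ j : Fin n, if j < i then (q.2 j).1 else 0))) * (q.2 i).2.2, -(r / 2) * (1 - (((q.2 i).2.1 ^ 2 + (q.2 i).2.2 ^ 2) / r ^ 2)) * Real.sin (∑ j : Fin n, if j < i then (q.2 j).1 else 0) * (2 / ((1 + (((q.2 i).2.1 ^ 2 + (q.2 i).2.2 ^ 2) / r ^ 2)) + (1 - (((q.2 i).2.1 ^ 2 + (q.2 i).2.2 ^ 2) / r ^ 2)) * Real.cos (∑ j : Fin n, if j < i then (q.2 j).1 else 0)))] : EuclideanSpace ℝ (Fin 3))) ∈ Literature.Probability.LatticeModels.NonCoincident 3 n}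

/-- item stmt-CriticalPhenomena-1981 · crux · rank 4 · SPLIT (gen 1) into TwoPointDoubling, ClusterSetTotallyDisconnected + glue Summit.CriticalPhenomena.Ising3DConformalLimit.Cruxes.ExistsScaleCovariantLimit.SplitGlue.hrp_crux_of_doubling_of_totallyDisconnected · direct attempts still welcome (low priority) · by planner
why it might fail: Existence of the δ→0 limit along the full family (not subsequences), translation invariance of S and pure-power scale covariance with one Δ are each open on ℤ³ (DuminilCopinICM2022 §8.4); ρ might need non-power (e.g. log-periodic) corrections.
sources: DuminilCopinICM2022, AizenmanDuminilCopinSidoravicius2015, PolandRychkovVichi2019, AizenmanDuminilCopinAnnals2021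
[crux r4, (C), existence WITHOUT rotations] There are ρ > 0 on (0,1], Δ > 0 and S with
HasPointwiseScalingLimit (criticalCorr 3) ρ S, S = 0 off NonCoincident, IsNondegenerateTwoPoint S,
IsTranslationInvariant S, IsScaleCovariant Δ S. Strictly weaker than CritIsing3DEuclideanLimit (item
0638: rotations included) — on this route isotropy is OUTPUT. Inputs in tree:
criticalTwoPoint_bounds_holds (c|x|⁻² ≤ G ≤ C|x|⁻¹ ⇒ subsequential limits, Δ ∈ [1/2,1]); missing:
uniqueness/full-filter convergence and continuous scale covariance (DuminilCopinICM2022 §8.4 p.29: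
'widely open'). -/
@[route_item "route-CriticalPhenomena-ModularQuarterTurn", crux]
def ExistsScaleCovariantLimit : Prop :=
  ∃ (ρ : ℝ → ℝ) (Δ : ℝ) (S : Literature.Probability.LatticeModels.CorrFamily 3), (∀ δ ∈ Set.Ioc (0:ℝ) 1, 0 < ρ δ) ∧ 0 < Δ ∧ Literature.Probability.LatticeModels.HasPointwiseScalingLimit (Literature.Probability.LatticeModels.criticalCorr 3) ρ S ∧ (∀ n z, z ∉ Literature.Probability.LatticeModels.NonCoincident 3 n → S n z = 0) ∧ Literature.Probability.LatticeModels.IsNondegenerateTwoPoint S ∧ Literature.Probability.LatticeModels.IsTranslationInvariant S ∧ Literature.Probability.LatticeModels.IsScaleCovariant Δ S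

-- parent: ExistsScaleCovariantLimit · child (gen 1)
/--     item stmt-CriticalPhenomena-6150 · crux · rank 401 · open
    parent: ExistsScaleCovariantLimit · by planner
    why it might fail: Uniform doubling is open in print's own words (ADC21 Rem 5.10; after Def 5.11): two-point axiomatics (RP, MMS, IR, DCP lower bound) admit crossover profiles c|x|^(-3/2)+Ce^(-|x|/N)/|x| breaking it by N^(-1/4); Thm 5.12 gives regular scales of positive density only; DCP Thm 1.5: eta's existence open.
    sources: AizenmanDuminilCopinAnnals2021, arXiv:1912.07973, DuminilcopinPanis2025, arXiv:2404.05700, DuminilCopinICM2022, Literature.Probability.LatticeModels.criticalTwoPoint_bounds_holds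
[crux] (D) ALL-SCALE DOUBLING of the axial critical two-point function on ℤ³: there is κ > 0 with
g(2n) ≥ κ·g(n) for all n ≥ 1, g(n) := ⟨σ₀σ_{n e₁}⟩⁺_{β_c(3)} (card item M3; = D1 of card
every-scale-regular-multiplicative-fekete). With MMS it gives G(z′) ≍ G(z) for ‖z′‖ ≍ ‖z‖ in all
directions; it is the one open LATTICE input of the compactness half and is filed first (the import
cone of everything below is otherwise proved: criticalTwoPoint_bounds_holds,
messager_miracleSole_holds, RP lemmas). [difficulty: open-problem] -/
@[route_item "route-CriticalPhenomena-ModularQuarterTurn", crux]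
def TwoPointDoubling : Prop :=
  ∃ κ : ℝ, 0 < κ ∧ ∀ n : ℕ, 1 ≤ n → κ * Literature.Probability.LatticeModels.criticalTwoPoint 3 (Pi.single 0 (n : ℤ)) ≤ Literature.Probability.LatticeModels.criticalTwoPoint 3 (Pi.single 0 (2 * (n : ℤ)))

-- parent: ExistsScaleCovariantLimit · child (gen 1)
/--     item stmt-CriticalPhenomena-4659 · crux · rank 402 · open
    parent: ExistsScaleCovariantLimit · by planner
    why it might fail: Under Reg, TD ⇔ 𝒞 singleton ⇔ full convergence of F^{ρ★}_δ (the whole existence problem). Fails if Δ drifts (g=n^{-2Δ(n)} slowly varying ⇒ arc of pure-power cluster points), if Ising sits on a conformal manifold (Δ_{ε'}=3; numerics 3.83), or if cluster points evade locality (long-range arc).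
    sources: Rychkov2020 (arXiv:2007.14315 / doi:10.5802/crphys.23 pp. 8, 10: isolation of local CFTs is an expectation, not a theorem), PolandRychkovVichi2019 (arXiv:1805.04405 §V.B p.36: island shrinking open), KosPolandSimmonsDuffinVichi2016 (arXiv:1603.04436 §1), Reehorst2022 (arXiv:2111.12093), PaulosEtAl2016 (arXiv:1509.00008), BehanEtAl2017 (arXiv:1703.05325)
[crux] the cluster set 𝒞 of the self-normalised family is totally disconnected in the pointwise
(product) topology of CorrFamily 3 (on 𝒞, compact under Reg, this coincides with the locally uniform
topology; pointwise is the stronger ask otherwise). INTENDED ENGINE (card items (2)–(4), the route's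
point, layer 2): 𝒞 ⊆ 𝓘 := σ-correlator families of LOCAL unitary ℤ₂-symmetric 3D CFTs with exactly
one relevant odd and exactly one relevant non-identity even scalar and Δ_σ ≤ 1 (lattice side: OS
positivity, clustering, covariance and spectrum of cluster points), and 𝓘 is totally disconnected
(CFT side, lattice-blind: 'It is expected that most local CFTs are isolated. One exception are CFTs
with exactly marginal fields of dimension Δ = d … A folk conjecture says that exactly marginal
fields in d ≥ 3 require supersymmetry' — Rychkov2020, arXiv:2007.14315 p.8, read this session; LOCAL
= 'critical points of lattice models with finite-range interactions', ibid., which is what excludes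
the non-local long-range arc; an ANALYTIC isolation theorem for exact solutions of crossing — NOT a
finite-Λ positivity certificate, which only gives diam ≤ ε(Λ): refuter flag on the card, accepted).
Both halves -/
@[route_item "route-CriticalPhenomena-ModularQuarterTurn", crux]
def ClusterSetTotallyDisconnected : Prop :=
  IsTotallyDisconnected {S : Literature.Probability.LatticeModels.CorrFamily 3 | (∀ n x, x ∉ Literature.Probability.LatticeModels.NonCoincident 3 n → S n x = 0) ∧ ∃ u : ℕ → ℝ, (∀ k, u k ∈ Set.Ioc (0:ℝ) 1) ∧ Filter.Tendsto u Filter.atTop (nhds 0) ∧ ∀ n, TendstoLocallyUniformlyOn (fun k => Literature.Probability.LatticeModels.rescaledCorrelator (Literature.Probability.LatticeModels.criticalCorr 3) (fun δ : ℝ => (Literature.Probability.LatticeModels.criticalTwoPoint 3 (Pi.single 0 ⌊δ⁻¹⌋)) ^ (-(1/2:ℝ))) n (u k)) (S n) Filter.atTop (Literature.Probability.LatticeModels.NonCoincident 3 n)}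

/-- glue for the split of `ExistsScaleCovariantLimit`: landed theorem `Summit.CriticalPhenomena.Ising3DConformalLimit.Cruxes.ExistsScaleCovariantLimit.SplitGlue.hrp_crux_of_doubling_of_totallyDisconnected`. -/
theorem ExistsScaleCovariantLimitGlueBy_holds : TwoPointDoubling → ClusterSetTotallyDisconnected → ExistsScaleCovariantLimit := _root_.Summit.CriticalPhenomena.Ising3DConformalLimit.Cruxes.ExistsScaleCovariantLimit.SplitGlue.hrp_crux_of_doubling_of_totallyDisconnected

/-- item stmt-CriticalPhenomena-0636 · crux · rank 5 · open · by planner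
why it might fail: Non-triviality in d = 3 is open; the only rigorous tool, the random-current intersection identity, needs a LOWER bound on macroscopic intersections of two critical double-current clusters (d ≥ 4 gives the opposite, triviality).
sources: Aizenman1982, AizenmanDuminilCopinAnnals2021, DuminilCopinICM2022
Crux r4 (non-triviality in d=3): every non-degenerate pointwise scaling limit S of the renormalised
critical Ising correlators on Z^3 has connected four-point function U4 ≢ 0 on non-coincident
configurations. Intended tool: the random-current identity U4(x,y,z,t) =
−2⟨σxσy⟩⟨σzσt⟩·P^{xy,zt}[C_{n1+n2}(x) ∩ C_{n1+n2}(z) ≠ ∅] (Aizenman 1982; ADC2021 arXiv:1912.07973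
eq. (3.11)): non-Gaussianity ⇔ the intersection probability of the two double-current clusters at
macroscopic separation does not vanish as δ → 0. Contrast: for d ≥ 4 every such limit IS Gaussian
(Literature.Probability.LatticeModels.highDim_triviality). Its negation refutes the conjunct
Ising3DConformalLimit itself. -/
@[route_item "route-CriticalPhenomena-ModularQuarterTurn", crux]
def IsingEuclidUpgradeR4NonGaussian : Prop :=
  ∀ (ρ : ℝ → ℝ) (S : Literature.Probability.LatticeModels.CorrFamily 3), (∀ δ ∈ Set.Ioc (0:ℝ) 1, 0 < ρ δ) → Literature.Probability.LatticeModels.HasPointwiseScalingLimit (Literature.Probability.LatticeModels.criticalCorr 3) ρ S → Literature.Probability.LatticeModels.IsNondegenerateTwoPoint S → Literature.Probability.LatticeModels.HasNontrivialU4 S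

/-- item stmt-CriticalPhenomena-6495 · support · rank 9 · closed · proved by Summit.CriticalPhenomena.Ising3DConformalLimit.Theorems.quarterTurnAnchors_proof @ c74ebfb96397 (prover) · by planner
sources: Baxter1976, PeschelKaulkeLegeza1999, FILS1978, FriedliVelenik2017
[support] (Card item A0 in exact form; provable now.) For every box size L: with P, E, Pr, B as in
WedgeModularRotation (mesh irrelevant) and A := cfc (x ↦ x^{1/4}) B the PSD fourth root, for all
four observables g₀,…,g₃ of the half-plane configuration, Tr(A·diag g₃·A·diag g₂·A·diag g₁·A·diag
g₀) = ⟨∏_k g_k(ω∘R^k|_P)⟩_{Λ,β_c,+} where R(y) = (−y₁, y₀, y₂) is the lattice quarter turn about the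
hinge axis. Content: Z·√(Pr Pr') is the cut partition function (all in-plane bond conventions
cancel), so B = ⊕_h Ã_h⁴/Z blockwise in the hinge configuration h, where Ã_h is Baxter's corner
transfer operator of the quadrant {x₀,x₁ ≥ 0} (walls weighted ½, hinge line ¼); Ã_h is symmetric and
PSD by reflection positivity in the diagonal site-plane x₀ = x₁, which no n.n. bond crosses (pattern
of the proved isingMeasure_univ_free_reflectionPositive); uniqueness of PSD fourth roots gives A =
⊕_h Ã_h / Z^{1/4}, and the CTM trace formula gives the identity. This is "quarter turns have
positive roots" made exact and anchors WedgeModularRotation at all multiples of π/2. [difficulty: L] -/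
@[route_item "route-CriticalPhenomena-ModularQuarterTurn", crux]
def QuarterTurnAnchors : Prop :=
  ∀ L : ℕ, (let P : Finset (Literature.Probability.LatticeModels.Site 3) := (Literature.Probability.LatticeModels.box 3 L).filter (fun x => x 1 = 0 ∧ 0 ≤ x 0); let E : Finset (Literature.Probability.LatticeModels.Site 3) := (Literature.Probability.LatticeModels.box 3 L).filter (fun x => x 1 = 0 ∧ x 0 < 0); let Pr : (↥P → ℤˣ) → (↥E → ℤˣ) → ℝ := fun σ η => Literature.Probability.LatticeModels.isingExpect (Literature.Probability.LatticeModels.zdGraph 3) (Literature.Probability.LatticeModels.box 3 L) (Literature.Probability.LatticeModels.criticalBeta 3) 0 Literature.Probability.LatticeModels.BoundaryCondition.plus (fun ω => (∏ x : ↥P, if ω x.1 = σ x then (1:ℝ) else 0) * ∏ y : ↥E, if ω y.1 = η y then (1:ℝ) else 0); let B : Matrix (↥P → ℤˣ) (↥P → ℤˣ) ℝ := Matrix.of (fun σ' σ => if (∀ x : ↥P, x.1 0 = 0 → σ' x = σ x) then ∑ η : ↥E → ℤˣ, Real.sqrt (Pr σ' η * Pr σ η) else 0); let A : Matrix (↥P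 → ℤˣ) (↥P → ℤˣ) ℝ := cfc (fun x : ℝ => x ^ (1 / 4 : ℝ)) B; ∀ g : Fin 4 → ((↥P → ℤˣ) → ℝ), Matrix.trace (A * Matrix.diagonal (g 3) * A * Matrix.diagonal (g 2) * A * Matrix.diagonal (g 1) * A * Matrix.diagonal (g 0)) = Literature.Probability.LatticeModels.isingExpect (Literature.Probability.LatticeModels.zdGraph 3) (Literature.Probability.LatticeModels.box 3 L) (Literature.Probability.LatticeModels.criticalBeta 3) 0 Literature.Probability.LatticeModels.BoundaryCondition.plus (fun ω => ∏ k : Fin 4, g k (fun x => ω ((fun y : Literature.Probability.LatticeModels.Site 3 => (![-(y 1), y 0, y 2] : Literature.Probability.LatticeModels.Site 3))^[k] x.1))))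

-- `QuarterTurnAnchors` holds: proved by `Summit.CriticalPhenomena.Ising3DConformalLimit.Theorems.quarterTurnAnchors_proof` @ c74ebfb96397 (its module imports this route file, so no `_holds` link can be stated here).

/-- item stmt-CriticalPhenomena-6496 · support · rank 9 · closed · proved by Summit.CriticalPhenomena.Ising3DConformalLimit.ModularQuarterTurnAxial.axialRotationUpgrade_proof @ 8602f090ab56 (prover) · by planner
sources: DuminilCopinICM2022, FriedliVelenik2017
[support] (Card item A3, group bookkeeping for rotations; provable now.) If S is a normalised,
translation-invariant pointwise scaling limit of criticalCorr 3 (hypotheses as in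
WedgeModularRotation) and S n (cyl(c,p)) = S n (cyl(c',p)) for all offsets c, c' whenever (c,p) lies
in the wedge domain (whose conditions do not involve the offset; this is the exact shape of the
conclusion of WedgeModularRotation: invariance under rotations about the x₂-axis for angle-sorted
configurations off the axis), then IsRotationInvariant S (all of O(3), all configurations). Proof
sketch: permutation symmetry of S from the lattice; configurations meeting the axis via a parallel
axis and translation invariance; the other coordinate axes by the exact coordinate-permutation
symmetry of criticalCorr and ⌊·⌋; reflections x ↦ −x via ⌊−t⌋ = −⌊t⌋−1 = a common lattice
translation plus translation invariance of S; two axial SO(2)'s generate SO(3). [difficulty: M] -/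
@[route_item "route-CriticalPhenomena-ModularQuarterTurn", crux]
def AxialRotationUpgrade : Prop :=
  ∀ (ρ : ℝ → ℝ) (Δ : ℝ) (S : Literature.Probability.LatticeModels.CorrFamily 3), (∀ δ ∈ Set.Ioc (0:ℝ) 1, 0 < ρ δ) → 0 < Δ → Literature.Probability.LatticeModels.HasPointwiseScalingLimit (Literature.Probability.LatticeModels.criticalCorr 3) ρ S → (∀ n z, z ∉ Literature.Probability.LatticeModels.NonCoincident 3 n → S n z = 0) → Literature.Probability.LatticeModels.IsNondegenerateTwoPoint S → Literature.Probability.LatticeModels.IsTranslationInvariant S → Literature.Probability.LatticeModels.IsScaleCovariant Δ S → (∀ (n : ℕ) (c c' : ℝ) (p : Fin n → ℝ × ℝ × ℝ), (c, p) ∈ {q : ℝ × (Fin n → ℝ × ℝ × ℝ) | (∀ i, 0 ≤ (q.2 i).1 ∧ 0 < (q.2 i).2.1) ∧ ∑ i, (q.2 i).1 = 2 * Real.pi ∧ (fun i : Fin n => (!₂[(q.2 i).2.1 * Real.cos (∑ j : Fin n, if j < i then (q.2 j).1 else 0), (q.2 i).2.1 * Real.sin (∑ j : Fin n, if j < i then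 (q.2 j).1 else 0), (q.2 i).2.2] : EuclideanSpace ℝ (Fin 3))) ∈ Literature.Probability.LatticeModels.NonCoincident 3 n} → S n (fun i : Fin n => (!₂[((c, p).2 i).2.1 * Real.cos ((c, p).1 + ∑ j : Fin n, if j < i then ((c, p).2 j).1 else 0), ((c, p).2 i).2.1 * Real.sin ((c, p).1 + ∑ j : Fin n, if j < i then ((c, p).2 j).1 else 0), ((c, p).2 i).2.2] : EuclideanSpace ℝ (Fin 3))) = S n (fun i : Fin n => (!₂[((c', p).2 i).2.1 * Real.cos ((c', p).1 + ∑ j : Fin n, if j < i then ((c', p).2 j).1 else 0), ((c', p).2 i).2.1 * Real.sin ((c', p).1 + ∑ j : Fin n, if j < i then ((c', p).2 j).1 else 0), ((c', p).2 i).2.2] : EuclideanSpace ℝ (Fin 3)))) → Literature.Probability.LatticeModels.IsRotationInvariant S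

-- `AxialRotationUpgrade` holds: proved by `Summit.CriticalPhenomena.Ising3DConformalLimit.ModularQuarterTurnAxial.axialRotationUpgrade_proof` @ 8602f090ab56 (its module imports this route file, so no `_holds` link can be stated here).

/-- item stmt-CriticalPhenomena-6497 · support · rank 9 · closed · proved by Summit.CriticalPhenomena.Ising3DConformalLimit.ModularQuarterTurnToroidal.toroidalInversionUpgrade_proof @ b26b350acaf3 (prover) · by planner
sources: HislopLongo1982, BrunettiGuidoLongo1993
[support] (Card item A3, group bookkeeping for inversion; provable now, pure Möbius geometry.) If S
is normalised, Euclidean invariant and scale covariant with Δ > 0 (plus the scaling-limit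
hypotheses, used only for permutation symmetry) and, for every r > 0, (∏J)^Δ · S n (M_ψ-images) is
independent of the common toroidal offset c on the disc domain (offset-free membership conditions;
the exact shape of the conclusion of BallModularMoebius), then IsInversionCovariant Δ S. Proof
sketch: every configuration avoiding the rim circle is an M-image of disc points (toroidal
coordinates cover ℝ³ minus the circle; choose the plane generically); offset c ↦ c+π realises M_π =
(inversion in the sphere of radius r) ∘ (x₂ ↦ −x₂) with J(ψ+π)/J(ψ) = |M_π'| = r²/|x|²; remove the
reflection by Euclidean invariance and the radius by scale covariance. [difficulty: M] -/
@[route_item "route-CriticalPhenomena-ModularQuarterTurn", crux]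
def ToroidalInversionUpgrade : Prop :=
  ∀ (ρ : ℝ → ℝ) (Δ : ℝ) (S : Literature.Probability.LatticeModels.CorrFamily 3), (∀ δ ∈ Set.Ioc (0:ℝ) 1, 0 < ρ δ) → 0 < Δ → Literature.Probability.LatticeModels.HasPointwiseScalingLimit (Literature.Probability.LatticeModels.criticalCorr 3) ρ S → (∀ n z, z ∉ Literature.Probability.LatticeModels.NonCoincident 3 n → S n z = 0) → Literature.Probability.LatticeModels.IsNondegenerateTwoPoint S → Literature.Probability.LatticeModels.IsEuclideanInvariant S → Literature.Probability.LatticeModels.IsScaleCovariant Δ S → (∀ r : ℝ, 0 < r → ∀ (n : ℕ) (c c' : ℝ) (p : Fin n → ℝ × ℝ × ℝ), (c, p) ∈ {q : ℝ × (Fin n → ℝ × ℝ × ℝ) | (∀ i, 0 ≤ (q.2 i).1 ∧ 0 < (q.2 i).2.1 ^ 2 + (q.2 i).2.2 ^ 2 ∧ (q.2 i).2.1 ^ 2 + (q.2 i).2.2 ^ 2 < r ^ 2) ∧ ∑ i, (q.2 i).1 = 2 * Real.pi ∧ (fun i : Fin n => (!₂[(2 / ((1 + (((q.2 i).2.1 ^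 2 + (q.2 i).2.2 ^ 2) / r ^ 2)) + (1 - (((q.2 i).2.1 ^ 2 + (q.2 i).2.2 ^ 2) / r ^ 2)) * Real.cos (∑ j : Fin n, if j < i then (q.2 j).1 else 0))) * (q.2 i).2.1, (2 / ((1 + (((q.2 i).2.1 ^ 2 + (q.2 i).2.2 ^ 2) / r ^ 2)) + (1 - (((q.2 i).2.1 ^ 2 + (q.2 i).2.2 ^ 2) / r ^ 2)) * Real.cos (∑ j : Fin n, if j < i then (q.2 j).1 else 0))) * (q.2 i).2.2, -(r / 2) * (1 - (((q.2 i).2.1 ^ 2 + (q.2 i).2.2 ^ 2) / r ^ 2)) * Real.sin (∑ j : Fin n, if j < i then (q.2 j).1 else 0) * (2 / ((1 + (((q.2 i).2.1 ^ 2 + (q.2 i).2.2 ^ 2) / r ^ 2)) + (1 - (((q.2 i).2.1 ^ 2 + (q.2 i).2.2 ^ 2) / r ^ 2)) * Real.cos (∑ j : Fin n, if j < i then (q.2 j).1 else 0)))] : EuclideanSpace ℝ (Fin 3))) ∈ Literature.Probability.LatticeModels.NonCoincident 3 n} → (∏ i : Fin n, (2 / ((1 + ((((c, p).2 i).2.1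 ^ 2 + ((c, p).2 i).2.2 ^ 2) / r ^ 2)) + (1 - ((((c, p).2 i).2.1 ^ 2 + ((c, p).2 i).2.2 ^ 2) / r ^ 2)) * Real.cos ((c, p).1 + ∑ j : Fin n, if j < i then ((c, p).2 j).1 else 0)))) ^ Δ * S n (fun i : Fin n => (!₂[(2 / ((1 + ((((c, p).2 i).2.1 ^ 2 + ((c, p).2 i).2.2 ^ 2) / r ^ 2)) + (1 - ((((c, p).2 i).2.1 ^ 2 + ((c, p).2 i).2.2 ^ 2) / r ^ 2)) * Real.cos ((c, p).1 + ∑ j : Fin n, if j < i then ((c, p).2 j).1 else 0))) * ((c, p).2 i).2.1, (2 / ((1 + ((((c, p).2 i).2.1 ^ 2 + ((c, p).2 i).2.2 ^ 2) / r ^ 2)) + (1 - ((((c, p).2 i).2.1 ^ 2 + ((c, p).2 i).2.2 ^ 2) / r ^ 2)) * Real.cos ((c, p).1 + ∑ j : Fin n, if j < i then ((c, p).2 j).1 else 0))) * ((c, p).2 i).2.2, -(r / 2) * (1 - ((((c, p).2 i).2.1 ^ 2 + ((c, p).2 i).2.2 ^ 2) / r ^ 2)) * Real.sin ((c, p).1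 + ∑ j : Fin n, if j < i then ((c, p).2 j).1 else 0) * (2 / ((1 + ((((c, p).2 i).2.1 ^ 2 + ((c, p).2 i).2.2 ^ 2) / r ^ 2)) + (1 - ((((c, p).2 i).2.1 ^ 2 + ((c, p).2 i).2.2 ^ 2) / r ^ 2)) * Real.cos ((c, p).1 + ∑ j : Fin n, if j < i then ((c, p).2 j).1 else 0)))] : EuclideanSpace ℝ (Fin 3))) = (∏ i : Fin n, (2 / ((1 + ((((c', p).2 i).2.1 ^ 2 + ((c', p).2 i).2.2 ^ 2) / r ^ 2)) + (1 - ((((c', p).2 i).2.1 ^ 2 + ((c', p).2 i).2.2 ^ 2) / r ^ 2)) * Real.cos ((c', p).1 + ∑ j : Fin n, if j < i then ((c', p).2 j).1 else 0)))) ^ Δ * S n (fun i : Fin n => (!₂[(2 / ((1 + ((((c', p).2 i).2.1 ^ 2 + ((c', p).2 i).2.2 ^ 2) / r ^ 2)) + (1 - ((((c', p).2 i).2.1 ^ 2 + ((c', p).2 i).2.2 ^ 2) / r ^ 2)) * Real.cos ((c', p).1 + ∑ j : Fin n, if j < i then ((c', p).2 j).1 else 0))) * ((c', p).2 i).2.1,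 (2 / ((1 + ((((c', p).2 i).2.1 ^ 2 + ((c', p).2 i).2.2 ^ 2) / r ^ 2)) + (1 - ((((c', p).2 i).2.1 ^ 2 + ((c', p).2 i).2.2 ^ 2) / r ^ 2)) * Real.cos ((c', p).1 + ∑ j : Fin n, if j < i then ((c', p).2 j).1 else 0))) * ((c', p).2 i).2.2, -(r / 2) * (1 - ((((c', p).2 i).2.1 ^ 2 + ((c', p).2 i).2.2 ^ 2) / r ^ 2)) * Real.sin ((c', p).1 + ∑ j : Fin n, if j < i then ((c', p).2 j).1 else 0) * (2 / ((1 + ((((c', p).2 i).2.1 ^ 2 + ((c', p).2 i).2.2 ^ 2) / r ^ 2)) + (1 - ((((c', p).2 i).2.1 ^ 2 + ((c', p).2 i).2.2 ^ 2) / r ^ 2)) * Real.cos ((c', p).1 + ∑ j : Fin n, if j < i then ((c', p).2 j).1 else 0)))] : EuclideanSpace ℝ (Fin 3)))) → Literature.Probability.LatticeModels.IsInversionCovariant Δ S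

-- `ToroidalInversionUpgrade` holds: proved by `Summit.CriticalPhenomena.Ising3DConformalLimit.ModularQuarterTurnToroidal.toroidalInversionUpgrade_proof` @ b26b350acaf3 (its module imports this route file, so no `_holds` link can be stated here).

/-- item stmt-CriticalPhenomena-6498 · support · rank 9 · closed · proved by Summit.CriticalPhenomena.Ising3DConformalLimit.Theorems.finiteVolumeScalingLimit_proof @ 1e515ac3fb72 (prover) · by planner
sources: FriedliVelenik2017, AizenmanDuminilCopinSidoravicius2015
[support] (Card item A4, limit interchange; provable now from GKS.) If ρ(δ)^n⟨∏σ_{[x_i/δ]}⟩⁺_{β_c} →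
S n locally uniformly on NonCoincident, then there is L₀ : ℝ → ℕ such that for every box growth L ≥
L₀ the + boundary box correlators ρ(δ)^n⟨∏σ_{[x_i/δ]}⟩_{Λ_{L(δ)},β_c,+} have the same locally
uniform limit S n. (At each fixed δ only finitely many lattice configurations matter on a compact
exhaustion, and ⟨σ_A⟩⁺_Λ ↓ ⟨σ_A⟩⁺ by GKS — hasBoxLimit_isingCorr_plus_holds — so L₀(δ) can be chosen
with error ≤ δ·ρ(δ)^{-n} for all n ≤ 1/δ.) Used by the provers of both modular cruxes to identify
the anchored values with S. [difficulty: M] -/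
@[route_item "route-CriticalPhenomena-ModularQuarterTurn", crux]
def FiniteVolumeScalingLimit : Prop :=
  ∀ (ρ : ℝ → ℝ) (S : Literature.Probability.LatticeModels.CorrFamily 3), (∀ δ ∈ Set.Ioc (0:ℝ) 1, 0 < ρ δ) → Literature.Probability.LatticeModels.HasPointwiseScalingLimit (Literature.Probability.LatticeModels.criticalCorr 3) ρ S → ∃ L₀ : ℝ → ℕ, ∀ L : ℝ → ℕ, (∀ δ, L₀ δ ≤ L δ) → ∀ n : ℕ, TendstoLocallyUniformlyOn (fun (δ : ℝ) (x : Fin n → EuclideanSpace ℝ (Fin 3)) => ρ δ ^ n * Literature.Probability.LatticeModels.isingExpect (Literature.Probability.LatticeModels.zdGraph 3) (Literature.Probability.LatticeModels.box 3 (L δ)) (Literature.Probability.LatticeModels.criticalBeta 3) 0 Literature.Probability.LatticeModels.BoundaryCondition.plus (Literature.Probability.LatticeModels.spinMonomial (fun i => Literature.Probability.LatticeModels.latticeApprox δ (x i)))) (S n) (nhdsWithin (0:ℝ) (Set.Ioi 0)) (Literature.Probability.LatticeModels.NonCoincident 3 n)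

-- `FiniteVolumeScalingLimit` holds: proved by `Summit.CriticalPhenomena.Ising3DConformalLimit.Theorems.finiteVolumeScalingLimit_proof` @ 1e515ac3fb72 (its module imports this route file, so no `_holds` link can be stated here).

-- earlier Assembly (stmt-CriticalPhenomena-6499, replaced 2026-08-15T16:54:49Z -> stmt-CriticalPhenomena-11215): retired by None — ExistsScaleCovariantLimit → WedgeModularRotation → AxialRotationUpgrade → BallModularMoebius → ToroidalInversionUpgrade → IsingEuclidUpgradeR4NonGaussian → _root_.Ising3DConformalLimit
/-- item stmt-CriticalPhenomena-11215 · assembly · rank 1 · closed · proved by Summit.CriticalPhenomena.Ising3DConformalLimit.Theorems.modularQuarterTurn_assembly_proof @ e5562972aace (prover) · by planner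
sources: DuminilCopinICM2022, ChelkakHonglerIzyurov2015
[assembly] (restated 1:1 to clear the stale blocked_missing_decls flag; statement unchanged) E0 →
LBW → AxialRotationUpgrade → LCHM → ToroidalInversionUpgrade → NG → Ising3DConformalLimit: pure
logic plus uniqueness of locally uniform limits (the interpolated words do not contain the offset
c). A checked proof is attached as item evidence (AssemblyProof.lean) and is also the body of the
deciding theorem closes. -/
@[route_item "route-CriticalPhenomena-ModularQuarterTurn", crux]
def Assembly : Prop :=
  ExistsScaleCovariantLimit → WedgeModularRotation → AxialRotationUpgrade → BallModularMoebius → ToroidalInversionUpgrade → IsingEuclidUpgradeR4NonGaussian → Ising3DConformalLimit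

-- `Assembly` holds: proved by `Summit.CriticalPhenomena.Ising3DConformalLimit.Theorems.modularQuarterTurn_assembly_proof` @ e5562972aace (its module imports this route file, so no `_holds` link can be stated here).

/-! D-0027 §2.1 — DECIDING THEOREM (planner-authored via `route open/edit --closes-file`; by planner-rrepair-CriticalPhenomena-ModularQuart-693a2b9f-g2-0 2026-08-15T16:54:49Z):
its hypotheses are this route's items and its conclusion the sub-problem Statement (glue_lint), and it elaborates with this file. -/

/-- Deciding theorem (D-0027 §2.1): the route's items imply the sub-problem statement.
Pure logic plus uniqueness of limits: the interpolated lattice words do not contain the offset `c`,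
so their locally uniform limits agree at `(c,p)` and `(c',p)`; `AxialRotationUpgrade` and
`ToroidalInversionUpgrade` turn the resulting offset-independence into rotation invariance and
inversion covariance. `QuarterTurnAnchors`, `FiniteVolumeScalingLimit` (provable-now anchors used by
the crux provers) and the legacy `Assembly` item are carried as hypotheses but NOT used: the proof
below is the assembly argument itself. -/
@[closes "route-CriticalPhenomena-ModularQuarterTurn"] theorem closes (h_WedgeModularRotation : WedgeModularRotation) (h_BallModularMoebius : BallModularMoebius)
    (h_ExistsScaleCovariantLimit : ExistsScaleCovariantLimit)
    (h_IsingEuclidUpgradeR4NonGaussian : IsingEuclidUpgradeR4NonGaussian)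
    (h_QuarterTurnAnchors : QuarterTurnAnchors) (h_AxialRotationUpgrade : AxialRotationUpgrade)
    (h_ToroidalInversionUpgrade : ToroidalInversionUpgrade)
    (h_FiniteVolumeScalingLimit : FiniteVolumeScalingLimit) (h_Assembly : Assembly) :
    _root_.Ising3DConformalLimit := by
  obtain ⟨ρ, Δ, S, hρ, hΔ, hlim, hnorm, hnd, htr, hsc⟩ := h_ExistsScaleCovariantLimit
  -- (LBW) + bookkeeping ⇒ rotation invariance
  have hrot : Literature.Probability.LatticeModels.IsRotationInvariant S := by
    obtain ⟨L, hL⟩ := h_WedgeModularRotation ρ Δ S hρ hΔ hlim hnorm hnd htr hsc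
    refine h_AxialRotationUpgrade ρ Δ S hρ hΔ hlim hnorm hnd htr hsc ?_
    intro n c c' p hcp
    have hc'p := hcp
    exact tendsto_nhds_unique ((hL n).tendsto_at hcp) ((hL n).tendsto_at (a := (c', p)) hc'p)
  have heuc : Literature.Probability.LatticeModels.IsEuclideanInvariant S := ⟨htr, hrot⟩
  -- (LCHM) + bookkeeping ⇒ inversion covariance
  have hinv : Literature.Probability.LatticeModels.IsInversionCovariant Δ S := by
    refine h_ToroidalInversionUpgrade ρ Δ S hρ hΔ hlim hnorm hnd heuc hsc ?_
    intro r hr n c c' p hcp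
    obtain ⟨L, hL⟩ := h_BallModularMoebius ρ Δ S hρ hΔ hlim hnorm hnd heuc hsc r hr
    have hc'p := hcp
    exact tendsto_nhds_unique ((hL n).tendsto_at hcp) ((hL n).tendsto_at (a := (c', p)) hc'p)
  have hmoeb : Literature.Probability.LatticeModels.IsMoebiusCovariant Δ S := ⟨heuc, hsc, hinv⟩
  exact ⟨ρ, Δ, S, hρ, hΔ, hlim, hnd, hmoeb,
    h_IsingEuclidUpgradeR4NonGaussian ρ S hρ hlim hnd⟩

end Summit.CriticalPhenomena.Ising3DConformalLimit.Theses.ModularQuarterTurn
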